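import Summits.Ventures.HSemireg.WedgeHankelSubstitutionSwapEigenspaces

/-!
# Venture HSemireg — THE SWAP ON TH-7's CLASSES IN EVERY CHARACTERISTIC: `rank(SbC(0 1 1 0) − 1) = ⌈n/2⌉` and `dim ker(SbC(0 1 1 0) − 1) = ⌊n/2⌋ + 1` with NO condition on `2`;
# in characteristic `2` the swap is UNIPOTENT, `(S − 1)² = 0`, with Jordan type `(2, …, 2, 1^{[n even]})` — `⌈n/2⌉` blocks of size `2` and one of size `1` iff `n` is even

HONEST FRAMING. Part of the Lean index of the computation cell `pub-hsemireg` (seat p10 gen 21, Sunday typer «UNIFORM-IN-n»).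
Finite-dimensional EXTERIOR ALGEBRA + linear algebra ONLY: no variety, no cohomology theory, no sheaf, no Ext group, no semiregularity map;
nothing here says that HC / HC_CM / HC_AV holds; no Literature fact is declared or used.  Custodian versions as in `WedgeHankelSiegelIdeal` (1/3) and `WedgeHankelFrameChange`;
the dictionary (the swap `x ↔ y` on `Sym^n`; in characteristic `2` an involution is unipotent) is QUOTED, never asserted.

WHAT IS IN THE TREE.  K14 (`WedgeHankelSubstitutionSwapEigenspaces`, this seat): `SbC_swap_spikeBasis` (`E_p ↦ E_{rev p}`), `repr_SbC_swap`, `mem_ker_SbC_swap_sub_one_iff` (fixed ⇔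
palindromic), `linearIndependent_spike_sub_rev` (the anti-palindromes `E_a − E_{rev a}`, `2a < n`, every field), and for `2 ≠ 0` the dimensions `n/2 + 1`, `(n+1)/2`; J11
`SbC_swap_mul_swap`; K1 `finrank_ker_pow_eq_of_nilpotent`-style generalities.  THIS FILE (namespace `Summit.Ventures.HSemireg.Wedge.HankelFrameChange` continued; imports K14)
removes the hypothesis `2 ≠ 0` from the fixed-class count and types characteristic `2`:
* §298 EVERY CHARACTERISTIC: `SbC_swap_sub_one_spikeBasis` (`(S − 1)E_a = E_{rev a} − E_a`), **`range_SbC_swap_sub_one_le_span`** (`range(S − 1) ≤ span{E_a − E_{rev a} : 2a < n}`),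
  `finrank_range_SbC_swap_sub_one_le` (`≤ (n+1)/2`), **`le_finrank_range_SbC_swap_sub_one`** (`≥ (n+1)/2`: the images `−(E_a − E_{rev a})`, `2a < n`, are independent),
  **`finrank_range_SbC_swap_sub_one`: `rank(S − 1) = (n+1)/2`** and **`finrank_ker_SbC_swap_sub_one'`: `dim ker(S − 1) = n/2 + 1` WITHOUT `2 ≠ 0`** (the palindromes).
* §299 CHARACTERISTIC `2`: **`SbC_swap_sub_one_sq_charTwo`** (`(S − 1)² = 0`: unipotent), `range_SbC_swap_sub_one_le_ker_charTwo`, **`finrank_ker_SbC_swap_sub_one_pow_charTwo`**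
  (`dim ker (S − 1)^k = n + 1` for `k ≥ 2`): Jordan type `(2^{(n+1)/2}, 1^{[n even]})` — `(n+1)/2` blocks of size `2` (= `rank(S − 1)`) and `n/2 + 1 − (n+1)/2 = [n even]` blocks of size `1`.
NOT typed here: the other involutions `SbC(0 c c⁻¹ 0)`; anything Ext-side.  New names only.
-/

open Module

namespace Summit.Ventures.HSemireg.Wedge.HankelFrameChange

open Summit.Ventures.HSemireg.Wedge Summit.Ventures.HSemireg.Wedge.Kunneth Summit.Ventures.HSemireg.Wedge.Hankel
  Summit.Ventures.HSemireg.Wedge.BasisFree Summit.Ventures.HSemireg.Wedge.HankelSiegel Summit.Ventures.HSemireg.Wedge.HankelSiegelIdeal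
  Summit.Ventures.HSemireg.Wedge.KunnethKernel Summit.Ventures.HSemireg.Wedge.HankelRankOne Summit.Ventures.HSemireg.Wedge.KernelDuality

variable (K : Type*) [Field K] {n : ℕ}

/-! ## §298. Every characteristic: `rank(S − 1) = ⌈n/2⌉`, `dim ker(S − 1) = ⌊n/2⌋ + 1` -/

/-- `(SbC(0 1 1 0) − 1) E_a = E_{rev a} − E_a`. -/
theorem SbC_swap_sub_one_spikeBasis (a : Fin (n + 1)) : (SbC K 0 1 1 0 - 1) (spikeBasis K n a) = spikeBasis K n (Fin.rev a) - spikeBasis K n a := by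
  rw [LinearMap.sub_apply, Module.End.one_apply, SbC_swap_spikeBasis]

/-- **`range(SbC(0 1 1 0) − 1) ≤ span{E_a − E_{rev a} : 2a < n}`** (the image of `E_a` is `∓` such a vector, or `0` when `rev a = a`). -/
theorem range_SbC_swap_sub_one_le_span :
    LinearMap.range (SbC K 0 1 1 0 (n := n) - 1) ≤
      Submodule.span K (Set.range fun a : {a : Fin (n + 1) // 2 * (a : ℕ) < n} => spikeBasis K n a - spikeBasis K n (Fin.rev (a : Fin (n + 1)))) := by
  classical
  rw [LinearMap.range_eq_map, ← (spikeBasis K n).span_eq, Submodule.map_span, Submodule.span_le]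
  rintro _ ⟨_, ⟨a, rfl⟩, rfl⟩
  rw [SbC_swap_sub_one_spikeBasis]
  rcases Nat.lt_trichotomy (2 * (a : ℕ)) n with hlt | heq | hgt
  · -- `E_{rev a} − E_a = −(E_a − E_{rev a})`
    rw [← neg_sub]
    exact Submodule.neg_mem _ (Submodule.subset_span ⟨⟨a, hlt⟩, rfl⟩)
  · -- the middle spike is fixed
    have e : Fin.rev a = a := Fin.ext (by rw [Fin.val_rev]; omega)
    rw [e, sub_self]; exact Submodule.zero_mem _
  · -- `2a > n`: `rev a` has `2·rev a < n` and `E_{rev a} − E_a = E_{rev a} − E_{rev (rev a)}`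
    have h' : 2 * ((Fin.rev a : Fin (n + 1)) : ℕ) < n := by rw [Fin.val_rev]; omega
    have e : spikeBasis K n (Fin.rev a) - spikeBasis K n a = spikeBasis K n (Fin.rev a) - spikeBasis K n (Fin.rev (Fin.rev a)) := by rw [Fin.rev_rev]
    rw [e]
    exact Submodule.subset_span ⟨⟨Fin.rev a, h'⟩, rfl⟩

/-- `rank(S − 1) ≤ (n+1)/2`. -/
theorem finrank_range_SbC_swap_sub_one_le : finrank K ↥(LinearMap.range (SbC K 0 1 1 0 (n := n) - 1)) ≤ (n + 1) / 2 := by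
  classical
  refine (Submodule.finrank_mono (range_SbC_swap_sub_one_le_span K)).trans ((finrank_range_le_card _).trans ?_)
  let ι : {a : Fin (n + 1) // 2 * (a : ℕ) < n} → Fin ((n + 1) / 2) := fun a => ⟨(a : ℕ), by have := a.2; omega⟩
  have hι : Function.Injective ι := fun a a' e => Subtype.ext (Fin.ext (by simpa [ι] using congrArg Fin.val e))
  have h := Fintype.card_le_of_injective ι hι
  rwa [Fintype.card_fin] at h

/-- `rank(S − 1) ≥ (n+1)/2`: the images `(S − 1)E_a = −(E_a − E_{rev a})`, `2a < n`, are independent (K14). -/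
theorem le_finrank_range_SbC_swap_sub_one : (n + 1) / 2 ≤ finrank K ↥(LinearMap.range (SbC K 0 1 1 0 (n := n) - 1)) := by
  classical
  have hli := (linearIndependent_spike_sub_rev K (n := n)).neg
  let v : {a : Fin (n + 1) // 2 * (a : ℕ) < n} → ↥(LinearMap.range (SbC K 0 1 1 0 (n := n) - 1)) := fun a =>
    ⟨-(spikeBasis K n a - spikeBasis K n (Fin.rev (a : Fin (n + 1)))), ⟨spikeBasis K n a, by rw [SbC_swap_sub_one_spikeBasis, neg_sub]⟩⟩
  have hv : LinearIndependent K v := LinearIndependent.of_comp (LinearMap.range (SbC K 0 1 1 0 (n := n) - 1)).subtype hli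
  refine le_trans ?_ hv.fintype_card_le_finrank
  let ι : Fin ((n + 1) / 2) → {a : Fin (n + 1) // 2 * (a : ℕ) < n} := fun j => ⟨⟨j, by omega⟩, by show 2 * (j : ℕ) < n; omega⟩
  have hι : Function.Injective ι := fun j j' e => Fin.ext (by simpa [ι] using congrArg (fun x => ((x.1 : Fin (n + 1)) : ℕ)) e)
  have h := Fintype.card_le_of_injective ι hι
  rwa [Fintype.card_fin] at h

/-- **`rank(SbC(0 1 1 0) − 1) = (n+1)/2` IN EVERY CHARACTERISTIC** (`= ⌈n/2⌉`). -/
theorem finrank_range_SbC_swap_sub_one : finrank K ↥(LinearMap.range (SbC K 0 1 1 0 (n := n) - 1)) = (n + 1) / 2 :=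
  le_antisymm (finrank_range_SbC_swap_sub_one_le K) (le_finrank_range_SbC_swap_sub_one K)

/-- **`dim ker(SbC(0 1 1 0) − 1) = n/2 + 1` IN EVERY CHARACTERISTIC** — the palindromic classes (K14's count without the hypothesis `2 ≠ 0`). -/
theorem finrank_ker_SbC_swap_sub_one' : finrank K ↥(LinearMap.ker (SbC K 0 1 1 0 (n := n) - 1)) = n / 2 + 1 := by
  have h := LinearMap.finrank_range_add_finrank_ker (SbC K 0 1 1 0 (n := n) - 1)
  rw [finrank_range_SbC_swap_sub_one, finrank_eq_card_basis (spikeBasis K n), Fintype.card_fin] at h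
  omega

/-! ## §299. Characteristic `2`: the swap is unipotent with Jordan type `(2, …, 2, 1^{[n even]})` -/

/-- **characteristic `2`: `(SbC(0 1 1 0) − 1)² = 0`** (`S² = 1` and `(S − 1)² = S² − 2S + 1 = 2(1 − S) = 0`). -/
theorem SbC_swap_sub_one_sq_charTwo [CharP K 2] : (SbC K 0 1 1 0 (n := n) - 1) ^ 2 = 0 := by
  have h2 : (2 : K) = 0 := by have h := CharP.cast_eq_zero K 2; exact_mod_cast h
  have hxx : ∀ x : spikeSpan K n, x + x = 0 := fun x => by rw [← two_smul K x, h2, zero_smul]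
  refine LinearMap.ext fun v => ?_
  have hSS : SbC K 0 1 1 0 (SbC K 0 1 1 0 v) = v := by rw [← Module.End.mul_apply, SbC_swap_mul_swap, Module.End.one_apply]
  rw [pow_two, Module.End.mul_apply, LinearMap.sub_apply, Module.End.one_apply, LinearMap.sub_apply, Module.End.one_apply, map_sub, hSS, LinearMap.zero_apply]
  have e : v - SbC K 0 1 1 0 v - (SbC K 0 1 1 0 v - v) = (v + v) - (SbC K 0 1 1 0 v + SbC K 0 1 1 0 v) := by abel
  rw [e, hxx, hxx, sub_zero]

/-- characteristic `2`: `range(S − 1) ≤ ker(S − 1)`. -/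
theorem range_SbC_swap_sub_one_le_ker_charTwo [CharP K 2] : LinearMap.range (SbC K 0 1 1 0 (n := n) - 1) ≤ LinearMap.ker (SbC K 0 1 1 0 (n := n) - 1) := by
  rw [LinearMap.range_le_ker_iff, ← Module.End.mul_eq_comp, ← pow_two, SbC_swap_sub_one_sq_charTwo]

/-- **characteristic `2`: `dim ker (SbC(0 1 1 0) − 1)^k = n + 1` for `k ≥ 2`** — with `dim ker(S − 1) = n/2 + 1` (§298): the swap has `(n+1)/2` Jordan blocks of size `2` and
`n/2 + 1 − (n+1)/2` (`= 1` if `n` is even, `0` if odd) of size `1`. -/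
theorem finrank_ker_SbC_swap_sub_one_pow_charTwo [CharP K 2] {k : ℕ} (hk : 2 ≤ k) : finrank K ↥(LinearMap.ker ((SbC K 0 1 1 0 (n := n) - 1) ^ k)) = n + 1 := by
  rw [pow_eq_zero_of_le hk (SbC_swap_sub_one_sq_charTwo K), LinearMap.ker_zero, finrank_top, finrank_eq_card_basis (spikeBasis K n), Fintype.card_fin]

/-- characteristic `2`: the number of Jordan blocks of size `2` of the swap is `(n+1)/2` and of size `1` is `n/2 + 1 − (n+1)/2` (recorded as the two kernel dimensions
`n/2 + 1 ≤ n + 1` with difference `(n+1)/2 = rank(S − 1)`). -/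
theorem finrank_ker_SbC_swap_sub_one_sq_sub_charTwo [CharP K 2] :
    finrank K ↥(LinearMap.ker ((SbC K 0 1 1 0 (n := n) - 1) ^ 2)) - finrank K ↥(LinearMap.ker (SbC K 0 1 1 0 (n := n) - 1)) = (n + 1) / 2 := by
  rw [finrank_ker_SbC_swap_sub_one_pow_charTwo K le_rfl, finrank_ker_SbC_swap_sub_one']
  omega

end Summit.Ventures.HSemireg.Wedge.HankelFrameChange
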